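import Literature.AlgebraicGeometry.Shioda1983.FermatThreefold
import HarnessLib

/-!
# Fermat cycles — GHC3-PRIME Lemma D: level-one characters of `X³_p` = terminal quintuples = empty cyclic 4-simplices

HONEST FRAMING: explicit algebraic cycles for specific Hodge classes on Fermat/Delsarte varieties;
residual open instances listed; no claim on general Hodge.

Topic path `Summits/HodgeConjecture/FermatCycles/` of cell `pub-hfermat` (new work, not literature). This file PROVES, for every
prime `p`, the elementary dictionary "Lemma D" of the cell note `pub-hfermat-search-2/GHC3-PRIME.md` §1 (search-2 gen-6; refereed
`REFEREE.md` v10.25 (B): "re-derived by hand … Sound"), on which Theorem A of that note rests (the universal certificates of its §3 are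
the companion file `GHC3PrimeCertificates.lean`). For a prime `p` and an ordered quintuple `a = (a₀,…,a₄) ∈ (ℤ/p)⁵` with all `aᵢ ≠ 0`
and `Σ aᵢ = 0`, writing `S_a(t) := Σᵢ ⟨t aᵢ⟩ ∈ ℕ` (least non-negative residues; `w(ta) = S_a(t)/p`), the following are equivalent:

* (1) `a ∈ I_p` — Shioda's level-one set for the Fermat threefold [Shioda1983WhatIsKnown, (13) p. 63]: `w(ta) ∈ {2, 3}` for every unit
  `t` (the tree's `Literature.AlgebraicGeometry.Shioda1983.IsLevelOne` of the multiset of values of `a`; `isLevelOne_iff`);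
* (2) `a` is a TERMINAL quintuple in the sense of Mori–Morrison–Morrison [MoriMorrisonMorrison1988] (terminality condition:
  `Σᵢ {t aᵢ / p} ≥ 2` for all `t = 1, …, p − 1`; `IsTerminal`);
* (3) the cyclic lattice 4-simplex `P(a) = p·Δ₄ ⊂ {Σ u = p}` read in the lattice `M'_a = {u ∈ ℤ⁵ : u ≡ t·a (mod p) for some t}` is EMPTY —
  its only lattice points are its five vertices `p·eⱼ` [IglesiasValinoSantos2021, §1 (cyclic simplices and their quintuples)] (`IsEmptySimplex`).

Proof (as in the note, five lines): `S_a(t) + S_a(−t) = 5p` and `p ∣ S_a(t)`, `5 ≤ S_a(t) ≤ 5p − 5` for `t ≠ 0`, so `S_a(t) ∈ {p, 2p, 3p, 4p}`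
(`resSum_cases`); (1) ⇔ (2) is then immediate; a lattice point `u` of `P(a)` with parameter `t = 0` is a vertex, and with `t ≠ 0` it forces
`uᵢ ≥ ⟨t aᵢ⟩`, i.e. `S_a(t) ≤ p`, i.e. `S_a(t) = p`, and conversely `u = (⟨t aᵢ⟩)ᵢ` is a non-vertex lattice point whenever `S_a(t) = p`.

WHAT THIS GIVES THE CELL (quoted, not formalised): with (1) ⇔ (3), the orbits of `I_p` under units and permutations are the isomorphism
classes of empty cyclic 4-simplices of (prime) volume `p` with zero-free quintuple, so the classification of empty lattice 4-simplices
[IglesiasValinoSantos2021, Thm 1.6] applies to them: for `p ≥ 421` only the `k = 1`, `k = 2` and the 29 stable-quintuple families occur, each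
with a universal Fine-interior certificate (`GHC3PrimeCertificates.universal29_ok`) — Theorem A of `GHC3-PRIME.md` (Hodge(X³_p, F′¹H³) for all
primes `p ≥ 421` by uniruled cyclic quotients; the Hodge-theoretic chain is NOT typed anywhere in the tree). Kernel sanity checks at the end:
Shioda's `(11; 1,1,5,7,8)` and the smallest prime wall `(41; 1,10,16,18,37)` are terminal, `(7; 1,1,1,1,3)` is not.

IN PRINT (located by the lit seat after this file first landed; `lit/TERMINAL-QUOTIENT-DICTIONARY-IN-PRINT.md`): the equivalence (1) ⇔ (2) is, once
"`a ∈ I_p`" is read as "the quintuple `a` is `p`-terminal", printed in [MoriMorrisonMorrison1988, (1.2) and the remark on CM-types, p. 771] ("condition (1.2)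
may be replaced by `2p ≤ a(k)+b(k)+c(k)+d(k)+e(k) ≤ 3p` for all `k` in a CM-type"); the FOUR-weight version of the dictionary (Fermat quadruples of the Fermat
surface = canonical cyclic threefold quotients via Reid's criterion; for prime `N` = White's lemma on empty lattice tetrahedra) is [Morrison1985CanonicalQuotient,
Definition and Thms 1–2, pp. 393–394] and [MorrisonStevens1984, Cor. 1.4]. The five-weight Fermat reading and (2) ⇔ (3) in this lattice form are the cell's.

References: [Shioda1983WhatIsKnown] T. Shioda, Adv. Stud. Pure Math. 1 (1983) 55–68, (13); [MoriMorrisonMorrison1988] S. Mori, D. R. Morrison,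
I. Morrison, Math. Comp. 51 (1988) 769–786; [IglesiasValinoSantos2021] Ó. Iglesias-Valiño, F. Santos, Rev. Mat. Iberoam. 37 (2021) 2399–2432
(arXiv:1908.08933, p. 4: quintuple of a cyclic simplex; Thm 1.6); [Morrison1985CanonicalQuotient] D. R. Morrison, Proc. AMS 93 (1985) 393–396;
[MorrisonStevens1984] D. R. Morrison, G. Stevens, Proc. AMS 90 (1984) 15–20; cell files `pub-hfermat-search-2/GHC3-PRIME.md` §1, `REFEREE.md` v10.25 (B),
`lit/TERMINAL-QUOTIENT-DICTIONARY-IN-PRINT.md`.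
-/

namespace Summit.HodgeConjecture.FermatCycles.GHC3PrimeLemmaD

open Finset
open Literature.AlgebraicGeometry.HodgeTheory.FermatCharacter (mNormSum)
open Literature.AlgebraicGeometry.Shioda1983 (IsLevelOne)

variable {p : ℕ}

/-! ### The three notions for an ordered quintuple -/

/-- `S_a(t) = Σᵢ ⟨t·aᵢ⟩`: the sum of the least non-negative residues of `t·a`, a natural number (`w(ta) = S_a(t)/p`).
[cite: Shioda1983WhatIsKnown, (13) p. 63] -/
def resSum (a : Fin 5 → ZMod p) (t : ZMod p) : ℕ := ∑ i, (t * a i).val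

/-- (1) for an ORDERED quintuple: `w(ta) ∈ {2, 3}`, i.e. `S_a(t) ∈ {2p, 3p}`, for every `t ≠ 0` (for prime `p` the units of `ℤ/p` are the
non-zero residues; equivalent to the tree's `IsLevelOne` of the value multiset, `isLevelOne_iff`). [cite: Shioda1983WhatIsKnown, (13) p. 63] -/
def IsLevelOneTuple (a : Fin 5 → ZMod p) : Prop :=
  ∀ t : ZMod p, t ≠ 0 → resSum a t = 2 * p ∨ resSum a t = 3 * p

/-- (2) the Mori–Morrison–Morrison TERMINALITY condition for the quintuple `a`: `Σᵢ {t·aᵢ/p} ≥ 2`, i.e. `S_a(t) ≥ 2p`, for all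
`t = 1, …, p − 1` — MMM's "`Q` is `p`-terminal", condition (1.2). [cite: MoriMorrisonMorrison1988, (1.2) p. 771] -/
def IsTerminal (a : Fin 5 → ZMod p) : Prop :=
  ∀ t : ZMod p, t ≠ 0 → 2 * p ≤ resSum a t

/-- Lattice points of the simplex `P(a) = p·Δ₄ = conv(p·e₀, …, p·e₄) ⊂ {Σ u = p}` for the lattice
`M'_a = {u ∈ ℤ⁵ : u ≡ t·a (mod p) for some t ∈ ℤ/p}`: `u ∈ ℕ⁵` with `Σ uᵢ = p` and `u ≡ t·a (mod p)` for some `t`.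
[cite: IglesiasValinoSantos2021, §1 (cyclic simplex with quintuple a)] -/
def IsLatticePoint (a : Fin 5 → ZMod p) (u : Fin 5 → ℕ) : Prop :=
  ∑ i, u i = p ∧ ∃ t : ZMod p, ∀ i, ((u i : ℕ) : ZMod p) = t * a i

/-- The vertices `p·eⱼ` of `P(a)`. [folklore] -/
def IsVertex (p : ℕ) (u : Fin 5 → ℕ) : Prop := ∃ j, u = Pi.single j p

/-- (3) `P(a)` is an EMPTY lattice simplex: its only lattice points are its vertices.
[cite: IglesiasValinoSantos2021, §1 (empty simplices)] -/
def IsEmptySimplex (a : Fin 5 → ZMod p) : Prop :=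
  ∀ u, IsLatticePoint a u → IsVertex p u

/-! ### Arithmetic of `S_a(t)` -/

/-- The vertices are lattice points (parameter `t = 0`). [folklore] -/
theorem isLatticePoint_vertex [NeZero p] (a : Fin 5 → ZMod p) (j : Fin 5) : IsLatticePoint a (Pi.single j p) := by
  refine ⟨?_, 0, fun i ↦ ?_⟩
  · fin_cases j <;> simp
  · by_cases h : i = j
    · subst h; simp
    · simp [h]

/-- `S_a(t) ≡ 0 (mod p)` when `Σ aᵢ = 0`: indeed `S_a(t) ≡ Σ t aᵢ = t Σ aᵢ`. [folklore] -/
theorem dvd_resSum [NeZero p] (a : Fin 5 → ZMod p) (hsum : ∑ i, a i = 0) (t : ZMod p) : p ∣ resSum a t := by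
  rw [← CharP.cast_eq_zero_iff (ZMod p) p]
  simp only [resSum, Nat.cast_sum, ZMod.natCast_zmod_val]
  rw [← Finset.mul_sum, hsum, mul_zero]

/-- For `t ≠ 0` (and `p` prime, all `aᵢ ≠ 0`): `5 ≤ S_a(t) ≤ 5p − 5`. [folklore] -/
theorem resSum_bounds [Fact p.Prime] (a : Fin 5 → ZMod p) (ha : ∀ i, a i ≠ 0) {t : ZMod p} (ht : t ≠ 0) :
    5 ≤ resSum a t ∧ resSum a t + 5 ≤ 5 * p := by
  have h : ∀ i, 1 ≤ (t * a i).val ∧ (t * a i).val < p := fun i ↦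
    ⟨Nat.one_le_iff_ne_zero.mpr (fun h0 ↦ mul_ne_zero ht (ha i) ((ZMod.val_eq_zero _).mp h0)), ZMod.val_lt _⟩
  have h0 := h 0; have h1 := h 1; have h2 := h 2; have h3 := h 3; have h4 := h 4
  simp only [resSum, Fin.sum_univ_five]
  omega

/-- For `t ≠ 0`: `S_a(t) + S_a(−t) = 5p` (`⟨x⟩ + ⟨−x⟩ = p` for `x ≠ 0`). [folklore] -/
theorem resSum_add_resSum_neg [Fact p.Prime] (a : Fin 5 → ZMod p) (ha : ∀ i, a i ≠ 0) {t : ZMod p} (ht : t ≠ 0) :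
    resSum a t + resSum a (-t) = 5 * p := by
  have h : ∀ i, (t * a i).val + (-t * a i).val = p := fun i ↦ by
    rw [neg_mul, ZMod.neg_val, if_neg (mul_ne_zero ht (ha i))]
    have := ZMod.val_lt (t * a i)
    omega
  have h0 := h 0; have h1 := h 1; have h2 := h 2; have h3 := h 3; have h4 := h 4
  simp only [resSum, Fin.sum_univ_five] at *
  omega

/-- For `t ≠ 0`: `S_a(t) ∈ {p, 2p, 3p, 4p}`. [folklore] -/
theorem resSum_cases [hp : Fact p.Prime] (a : Fin 5 → ZMod p) (ha : ∀ i, a i ≠ 0) (hsum : ∑ i, a i = 0)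
    {t : ZMod p} (ht : t ≠ 0) :
    resSum a t = p ∨ resSum a t = 2 * p ∨ resSum a t = 3 * p ∨ resSum a t = 4 * p := by
  obtain ⟨k, hk⟩ := dvd_resSum a hsum t
  obtain ⟨hlo, hhi⟩ := resSum_bounds a ha ht
  have hp2 := hp.out.two_le
  rw [hk] at hlo hhi ⊢
  have hk1 : 1 ≤ k := by
    rcases Nat.eq_zero_or_pos k with h | h
    · subst h; simp at hlo
    · exact h
  have hk4 : k ≤ 4 := by
    by_contra h
    have : p * 5 ≤ p * k := Nat.mul_le_mul_left p (by omega)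
    omega
  interval_cases k <;> simp [Nat.mul_comm]

/-! ### Lemma D -/

/-- **Lemma D, (1) ⇔ (2)**: level one ⇔ terminal — printed as "(1.2) may be replaced by `2p ≤ Σ ≤ 3p` on a CM-type".
[cite: MoriMorrisonMorrison1988, (1.2) and the CM-type remark, p. 771] -/
theorem isLevelOneTuple_iff_isTerminal [hp : Fact p.Prime] (a : Fin 5 → ZMod p) (ha : ∀ i, a i ≠ 0)
    (hsum : ∑ i, a i = 0) : IsLevelOneTuple a ↔ IsTerminal a := by
  refine ⟨fun h t ht ↦ ?_, fun h t ht ↦ ?_⟩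
  · rcases h t ht with h2 | h3 <;> omega
  · have h1 := h t ht
    have h2 := h (-t) (neg_ne_zero.mpr ht)
    have h3 := resSum_add_resSum_neg a ha ht
    have hp2 := hp.out.two_le
    rcases resSum_cases a ha hsum ht with e | e | e | e <;> omega

/-- **Lemma D, (2) ⇒ (3)**: a terminal quintuple has an empty simplex (a lattice point with parameter `t ≠ 0` would give
`S_a(t) ≤ p`; with `t = 0` it is a vertex); this direction needs neither `aᵢ ≠ 0` nor `Σ aᵢ = 0`. [folklore] -/
theorem isEmptySimplex_of_isTerminal [hp : Fact p.Prime] (a : Fin 5 → ZMod p)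
    (h : IsTerminal a) : IsEmptySimplex a := by
  intro u ⟨hu, t, ht⟩
  have hp2 := hp.out.two_le
  by_cases ht0 : t = 0
  · -- all `uᵢ ≡ 0 (mod p)`, `Σ uᵢ = p`: exactly one `uᵢ = p`
    subst ht0
    have hdvd : ∀ i, p ∣ u i := fun i ↦ by
      rw [← CharP.cast_eq_zero_iff (ZMod p) p, ht i, zero_mul]
    have hle : ∀ i, u i = 0 ∨ u i = p := fun i ↦ by
      obtain ⟨c, hc⟩ := hdvd i
      have hi : u i ≤ p := by
        rw [← hu]; exact Finset.single_le_sum (fun j _ ↦ Nat.zero_le (u j)) (Finset.mem_univ i)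
      rcases Nat.lt_or_ge c 2 with hc2 | hc2
      · interval_cases c <;> simp [hc]
      · have : p * 2 ≤ p * c := Nat.mul_le_mul_left p hc2
        omega
    have h0 := hle 0; have h1 := hle 1; have h2 := hle 2; have h3 := hle 3; have h4 := hle 4
    simp only [Fin.sum_univ_five] at hu
    have key : ∃ j, u j = p := by
      by_contra hno
      push Not at hno
      have hz : ∀ i, u i = 0 := fun i ↦ (hle i).resolve_right (hno i)
      rw [hz 0, hz 1, hz 2, hz 3, hz 4] at hu
      omega
    obtain ⟨j, hj⟩ := key
    refine ⟨j, funext fun i ↦ ?_⟩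
    by_cases hij : i = j
    · subst hij; simp [hj]
    · rcases hle i with hi0 | hi0
      · simp [hij, hi0]
      · exfalso
        fin_cases i <;> fin_cases j <;> simp at hij hi0 hj <;> omega
  · -- `t ≠ 0`: `uᵢ ≥ ⟨t aᵢ⟩`, so `S_a(t) ≤ Σ uᵢ = p < 2p ≤ S_a(t)`
    exfalso
    have hge : ∀ i, (t * a i).val ≤ u i := fun i ↦ by
      rw [← ht i, ZMod.val_natCast]; exact Nat.mod_le _ _
    have h2p := h t ht0
    have h0 := hge 0; have h1 := hge 1; have h2 := hge 2; have h3 := hge 3; have h4 := hge 4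
    simp only [resSum, Fin.sum_univ_five] at h2p hu
    omega

/-- **Lemma D, (3) ⇒ (2)**: if `S_a(t) = p` for some `t ≠ 0` then `u = (⟨t aᵢ⟩)ᵢ` is a non-vertex lattice point. [folklore] -/
theorem isTerminal_of_isEmptySimplex [hp : Fact p.Prime] (a : Fin 5 → ZMod p) (ha : ∀ i, a i ≠ 0) (hsum : ∑ i, a i = 0)
    (h : IsEmptySimplex a) : IsTerminal a := by
  intro t ht
  have hp2 := hp.out.two_le
  by_contra hlt
  have hS : resSum a t = p := by
    rcases resSum_cases a ha hsum ht with e | e | e | e <;> omega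
  -- the witness
  have hpt : IsLatticePoint a (fun i ↦ (t * a i).val) := ⟨hS, t, fun i ↦ by simp⟩
  obtain ⟨j, hj⟩ := h _ hpt
  have hj' := congrFun hj j
  have hlt' := ZMod.val_lt (t * a j)
  simp at hj'
  omega

/-- **Lemma D, (2) ⇔ (3)**. [folklore] -/
theorem isTerminal_iff_isEmptySimplex [Fact p.Prime] (a : Fin 5 → ZMod p) (ha : ∀ i, a i ≠ 0) (hsum : ∑ i, a i = 0) :
    IsTerminal a ↔ IsEmptySimplex a :=
  ⟨isEmptySimplex_of_isTerminal a, isTerminal_of_isEmptySimplex a ha hsum⟩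

/-! ### Bridge to the tree's `IsLevelOne` (Shioda's set `I`, multiset form) -/

/-- `Σ⟨t x⟩` over the value multiset of `a` is `S_a(t)`. [folklore] -/
theorem mNormSum_tuple (a : Fin 5 → ZMod p) (t : ZMod p) :
    mNormSum (((univ : Finset (Fin 5)).val.map a).map fun x ↦ t * x) = resSum a t := by
  simp only [mNormSum, Multiset.map_map, Function.comp_def, resSum]
  rfl

/-- The tree's `IsLevelOne` (Shioda's `I`, [Shioda1983WhatIsKnown, (13)]) of the value multiset of an ordered quintuple, for PRIME `p`,
is "(all `aᵢ ≠ 0`) and (1)". [cite: Shioda1983WhatIsKnown, (13) p. 63] -/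
theorem isLevelOne_iff [Fact p.Prime] (a : Fin 5 → ZMod p) :
    IsLevelOne ((univ : Finset (Fin 5)).val.map a) ↔ (∀ i, a i ≠ 0) ∧ IsLevelOneTuple a := by
  unfold IsLevelOne IsLevelOneTuple
  have hcard : Multiset.card (((univ : Finset (Fin 5)).val.map a)) = 5 := by simp
  have hne : (∀ x ∈ ((univ : Finset (Fin 5)).val.map a), x ≠ 0) ↔ ∀ i, a i ≠ 0 := by
    constructor
    · intro h i
      exact h (a i) (Multiset.mem_map.mpr ⟨i, Finset.mem_val.mpr (Finset.mem_univ i), rfl⟩)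
    · rintro h x hx
      obtain ⟨i, -, rfl⟩ := Multiset.mem_map.mp hx
      exact h i
  rw [hne]
  simp only [hcard, and_true, mNormSum_tuple]
  refine Iff.rfl.and ⟨fun h t ht ↦ h (Units.mk0 t ht), fun h u ↦ h u u.ne_zero⟩

/-- **Lemma D** (GHC3-PRIME §1) for a prime `p` and a zero-free quintuple with `Σ aᵢ = 0`: level one (Shioda's `I_p`, tree form) ⇔ terminal
(Mori–Morrison–Morrison) ⇔ empty cyclic simplex. [cite: MoriMorrisonMorrison1988, (1.2) p. 771]
[cite: IglesiasValinoSantos2021, §1] [cite: Shioda1983WhatIsKnown, (13) p. 63] -/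
theorem lemmaD [Fact p.Prime] (a : Fin 5 → ZMod p) (ha : ∀ i, a i ≠ 0) (hsum : ∑ i, a i = 0) :
    (IsLevelOne ((univ : Finset (Fin 5)).val.map a) ↔ IsTerminal a) ∧ (IsTerminal a ↔ IsEmptySimplex a) :=
  ⟨((isLevelOne_iff a).trans ⟨fun h ↦ h.2, fun h ↦ ⟨ha, h⟩⟩).trans (isLevelOneTuple_iff_isTerminal a ha hsum),
    isTerminal_iff_isEmptySimplex a ha hsum⟩

/-! ### Kernel sanity checks -/

/-- `IsTerminal` is decidable for concrete `p` (finite quantifier). [folklore] -/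
instance decIsTerminal [NeZero p] (a : Fin 5 → ZMod p) : Decidable (IsTerminal a) := by
  unfold IsTerminal; infer_instance

/-- Shioda's residual character `(1,1,5,7,8)` at `m = 11` [Shioda1983WhatIsKnown, (13) p. 64] is a terminal quintuple (so, by Lemma D,
in `I₁₁` with empty simplex). [cite: Shioda1983WhatIsKnown, (13) p. 64] -/
theorem isTerminal_eleven : IsTerminal (![1, 1, 5, 7, 8] : Fin 5 → ZMod 11) := by decide +kernel

/-- The smallest prime wall of `GHC3-PRIME.md` Thm B, `(41; 1,10,16,18,37)`, is a terminal quintuple (level one). [folklore] -/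
theorem isTerminal_fortyOne : IsTerminal (![1, 10, 16, 18, 37] : Fin 5 → ZMod 41) := by decide +kernel

/-- Non-example: `(7; 1,1,1,1,3)` (`Σ = 7`) is NOT terminal — `S(1) = 7 = p`, the lattice point `(1,1,1,1,3)`. [folklore] -/
theorem not_isTerminal_seven : ¬ IsTerminal (![1, 1, 1, 1, 3] : Fin 5 → ZMod 7) := by decide +kernel

end Summit.HodgeConjecture.FermatCycles.GHC3PrimeLemmaD
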